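import Literature.Geometry.Manifold.TranslationFlow
import Mathlib.Geometry.Manifold.IntegralCurve.Transform
import Mathlib.Topology.Connected.LocallyConnected
import HarnessLib

/-!
# Integral curves of a local lift of a constant field translate the base map, while inside

General differential topology (companion of `TranslationFlow.lean`, which treats fields `X`
with `dg(X) = c` EVERYWHERE on a manifold without boundary; Bröcker–Jänich 1982, proof of
(8.12), PDF pp. 57–58).  On a compact manifold (with boundary) no vector field can lift a
non-zero constant field everywhere (`g` would be unbounded along the flow), so the lifts used for
Ehresmann-type product structures over a box `Q` of the base are lifts only on a closed
neighbourhood `C ⊇ g⁻¹(Q)`; their integral curves translate `g` **as long as the translated value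
stays in `Q`**.  Any model with corners (boundary allowed), `g : M → F` of class `C¹` into a
normed space, `V` a vector field with `dg_x(V x) = c` for `x ∈ C`:

* `apply_integralCurve_eq_add_smul_of_mapsTo` — along an integral curve `γ` on an open interval
  `J` which stays in `C`, `g (γ t) = g (γ t₀) + (t - t₀) • c`;
* `apply_integralCurve_eq_add_smul_of_segment` — for an integral curve `γ` on `ℝ`, an open
  `Q ⊆ F` with `g⁻¹(Q) ⊆ C`, and a time `t` such that the whole segment
  `g (γ 0) + [0, t] • c` lies in `Q`: `g (γ s) = g (γ 0) + s • c` for all `s` between `0` and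
  `t` (continuation along the connected component of `0` in `{s | g (γ s) ∈ Q}`; the forward case
  `…_of_segment_of_nonneg`, the backward case by time reversal).

Everything is proved; no definitions.

## References

* Th. Bröcker, K. Jänich, *Introduction to Differential Topology*, CUP 1982, proof of (8.12)
  (PDF pp. 57–58). [BrockerJanichIDT1982]
-/

open scoped Manifold ContDiff Topology
open Set Function Filter

noncomputable section

namespace Literature.Geometry.Manifold

universe u

variable {E : Type u} [NormedAddCommGroup E] [NormedSpace ℝ E]
  {H : Type*} [TopologicalSpace H] {I : ModelWithCorners ℝ E H}
  {M : Type*} [TopologicalSpace M] [ChartedSpace H M]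
  {F : Type*} [NormedAddCommGroup F] [NormedSpace ℝ F]
  {g : M → F} {V : Π x : M, TangentSpace I x} {c : F} {C : Set M}

-- the tangent spaces of `F` and `ℝ` are `F` and `ℝ` by definition, which the derivative lemmas
-- for curves must see through
set_option backward.isDefEq.respectTransparency false in
/-- **A local lift of a constant field translates the base map along integral curves staying in
the lifting region** (Bröcker–Jänich 1982, proof of (8.12), localised): if `g` is `C¹`,
`dg_x(V x) = c` for `x ∈ C`, and `γ` is an integral curve of `V` on an open interval `J` with
`γ(J) ⊆ C`, then `g (γ t) = g (γ t₀) + (t - t₀) • c` for `t₀, t ∈ J`.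
[cite: BrockerJanichIDT1982, (8.12) (proof)] -/
theorem apply_integralCurve_eq_add_smul_of_mapsTo
    (hg : ContMDiff I 𝓘(ℝ, F) 1 g) (hc : ∀ x ∈ C, mfderiv I 𝓘(ℝ, F) g x (V x) = c)
    {γ : ℝ → M} {J : Set ℝ} (hJ : IsOpen J) (hJc : J.OrdConnected) (hγ : IsMIntegralCurveOn γ V J)
    (hγC : MapsTo γ J C) {t₀ t : ℝ} (ht₀ : t₀ ∈ J) (ht : t ∈ J) :
    g (γ t) = g (γ t₀) + (t - t₀) • c := by
  -- `g ∘ γ` has derivative `c` on `J`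
  have hd : ∀ s ∈ J, HasDerivAt (g ∘ γ) c s := by
    intro s hs
    have h1 : HasMFDerivAt 𝓘(ℝ, ℝ) I γ s ((1 : ℝ →L[ℝ] ℝ).smulRight (V (γ s))) :=
      (hγ s hs).hasMFDerivAt (hJ.mem_nhds hs)
    have h2 : HasMFDerivAt I 𝓘(ℝ, F) g (γ s) (mfderiv I 𝓘(ℝ, F) g (γ s)) :=
      (hg.mdifferentiableAt one_ne_zero).hasMFDerivAt
    have h3 := h2.comp s h1
    rw [hasMFDerivAt_iff_hasFDerivAt] at h3
    have h4 := h3.hasDerivAt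
    have h5 : ((mfderiv I 𝓘(ℝ, F) g (γ s)).comp ((1 : ℝ →L[ℝ] ℝ).smulRight (V (γ s)))) (1 : ℝ)
        = c := by
      rw [ContinuousLinearMap.comp_apply, ContinuousLinearMap.smulRight_apply,
        one_apply_eq_self, one_smul, hc _ (hγC hs)]
    exact h4.congr_deriv h5
  -- hence `g (γ s) - s • c` is constant on `J`
  have hk : ∀ s ∈ J, HasDerivAt (fun s => g (γ s) - s • c) 0 s := by
    intro s hs
    have h := (hd s hs).sub ((hasDerivAt_id s).smul_const c)
    simp only [id_eq, one_smul, sub_self] at h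
    exact h
  have hconst := hJ.is_const_of_deriv_eq_zero hJc.isPreconnected
    (fun s hs => (hk s hs).differentiableAt.differentiableWithinAt) (fun s hs => (hk s hs).deriv)
    ht ht₀
  rw [sub_eq_iff_eq_add] at hconst
  rw [hconst, sub_smul]
  abel

/-- **Continuation, forward in time.**  Let `g` be `C¹`, `dg_x(V x) = c` on `C`, `Q ⊆ F` open
with `g⁻¹(Q) ⊆ C`, `γ` an integral curve of `V` on `ℝ`, and `0 ≤ t` with
`g (γ 0) + s • c ∈ Q` for all `s ∈ [0, t]`.  Then `g (γ s) = g (γ 0) + s • c` for all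
`s ∈ [0, t]`.  Proof: let `J` be the connected component of `0` in the open set
`{s | g (γ s) ∈ Q}`; it is an open interval on which the translation formula holds
(`apply_integralCurve_eq_add_smul_of_mapsTo`).  If `[0, t] ⊄ J`, let `b` be the supremum of
the `r ∈ [0, t]` with `[0, r] ⊆ J`; then `[0, b) ⊆ J`, `b ∉ J`, and by continuity
`g (γ b) = g (γ 0) + b • c ∈ Q`, so `J ∪ {b}` is a preconnected subset of `{s | g (γ s) ∈ Q}`
containing `0`, whence `b ∈ J` — a contradiction. [cite: BrockerJanichIDT1982, (8.12) (proof)] -/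
theorem apply_integralCurve_eq_add_smul_of_segment_of_nonneg
    (hg : ContMDiff I 𝓘(ℝ, F) 1 g) (hc : ∀ x ∈ C, mfderiv I 𝓘(ℝ, F) g x (V x) = c)
    {Q : Set F} (hQ : IsOpen Q) (hQC : g ⁻¹' Q ⊆ C) {γ : ℝ → M} (hγ : IsMIntegralCurve γ V)
    {t : ℝ} (ht : 0 ≤ t) (hseg : ∀ s ∈ Icc 0 t, g (γ 0) + s • c ∈ Q) {s : ℝ} (hs : s ∈ Icc 0 t) :
    g (γ s) = g (γ 0) + s • c := by
  set O : Set ℝ := {s | g (γ s) ∈ Q} with hO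
  have hOo : IsOpen O := hQ.preimage (hg.continuous.comp hγ.continuous)
  have h0O : (0 : ℝ) ∈ O := by
    have h := hseg 0 (left_mem_Icc.2 ht)
    rw [zero_smul, add_zero] at h
    exact h
  set J : Set ℝ := connectedComponentIn O 0 with hJ
  have hJo : IsOpen J := hOo.connectedComponentIn
  have hJO : J ⊆ O := connectedComponentIn_subset O 0
  have h0J : (0 : ℝ) ∈ J := mem_connectedComponentIn h0O
  have hJc : J.OrdConnected := isPreconnected_iff_ordConnected.1 isPreconnected_connectedComponentIn
  -- translation on `J`
  have htr : ∀ r ∈ J, g (γ r) = g (γ 0) + r • c := by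
    intro r hr
    have h := apply_integralCurve_eq_add_smul_of_mapsTo hg hc hJo hJc (hγ.isMIntegralCurveOn J)
      (fun r' hr' => hQC (hJO hr')) h0J hr
    rw [sub_zero] at h
    exact h
  -- it suffices that `s ∈ J`
  suffices hsJ : s ∈ J from htr s hsJ
  by_contra hsJ
  -- the supremum `b` of the `r ∈ [0, s]` with `[0, r] ⊆ J`
  set A : Set ℝ := {r | r ∈ Icc 0 s ∧ Icc 0 r ⊆ J} with hA
  have h0A : (0 : ℝ) ∈ A := ⟨left_mem_Icc.2 hs.1, by rw [Icc_self]; exact singleton_subset_iff.2 h0J⟩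
  have hAbdd : BddAbove A := ⟨s, fun r hr => hr.1.2⟩
  set b := sSup A with hb
  have hb0 : 0 ≤ b := le_csSup hAbdd h0A
  have hbs : b ≤ s := csSup_le ⟨0, h0A⟩ fun r hr => hr.1.2
  have hIco : Ico 0 b ⊆ J := by
    intro r hr
    obtain ⟨a, haA, hra⟩ := exists_lt_of_lt_csSup ⟨0, h0A⟩ hr.2
    exact haA.2 ⟨hr.1, hra.le⟩
  -- `b ∉ J`
  have hbJ : b ∉ J := by
    intro hbJ'
    obtain ⟨δ, hδ, hδJ⟩ := Metric.isOpen_iff.1 hJo b hbJ'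
    -- then `[0, min (b + δ/2) s] ⊆ J`, contradicting the definition of `b` or `s ∉ J`
    set b' := min (b + δ / 2) s with hb'
    have hb'A : b' ∈ A := by
      refine ⟨⟨le_min (by linarith) hs.1, min_le_right _ _⟩, fun r hr => ?_⟩
      rcases lt_or_ge r b with hrb | hrb
      · exact hIco ⟨hr.1, hrb⟩
      · apply hδJ
        rw [Metric.mem_ball, Real.dist_eq, abs_lt]
        constructor <;> linarith [hr.2, min_le_left (b + δ / 2) s]
    have hb'b : b' ≤ b := le_csSup hAbdd hb'A
    rcases lt_or_ge b s with hbs' | hbs'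
    · have : b < b' := lt_min (by linarith) hbs'
      linarith
    · have hbeq : b = s := le_antisymm hbs hbs'
      exact hsJ (hbeq ▸ hbJ')
  have hb0' : 0 < b := lt_of_le_of_ne hb0 fun h => hbJ (h ▸ h0J)
  -- by continuity, `g (γ b) = g (γ 0) + b • c`
  have hcont₁ : ContinuousAt (fun r => g (γ r)) b :=
    (hg.continuous.comp hγ.continuous).continuousAt
  have hcont₂ : ContinuousAt (fun r => g (γ 0) + r • c) b :=
    (continuous_const.add (continuous_id.smul continuous_const)).continuousAt
  haveI : (𝓝[<] b).NeBot := nhdsLT_neBot b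
  have hlim₁ : Tendsto (fun r => g (γ r)) (𝓝[<] b) (𝓝 (g (γ b))) := hcont₁.tendsto.mono_left nhdsWithin_le_nhds
  have hlim₂ : Tendsto (fun r => g (γ r)) (𝓝[<] b) (𝓝 (g (γ 0) + b • c)) := by
    refine (hcont₂.tendsto.mono_left nhdsWithin_le_nhds).congr' ?_
    have hmem : Ioo 0 b ∈ 𝓝[<] b := Ioo_mem_nhdsLT hb0'
    filter_upwards [hmem] with r hr
    exact (htr r (hIco ⟨hr.1.le, hr.2⟩)).symm
  have hgb : g (γ b) = g (γ 0) + b • c := tendsto_nhds_unique hlim₁ hlim₂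
  have hbO : b ∈ O := by
    show g (γ b) ∈ Q
    rw [hgb]
    exact hseg b ⟨hb0, hbs.trans hs.2⟩
  -- `J ∪ {b}` is preconnected, inside `O`, contains `0`: so `b ∈ J`
  have hbcl : b ∈ closure J := by
    have h : b ∈ closure (Ico 0 b) := by rw [closure_Ico hb0'.ne]; exact right_mem_Icc.2 hb0
    exact closure_mono hIco h
  have hpre : IsPreconnected (insert b J) :=
    isPreconnected_connectedComponentIn.subset_closure (subset_insert _ _)
      (insert_subset hbcl subset_closure)
  have hsub : insert b J ⊆ J :=
    hpre.subset_connectedComponentIn (mem_insert_of_mem _ h0J) (insert_subset hbO hJO)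
  exact hbJ (hsub (mem_insert _ _))

/-- **Continuation, both time directions** (the backward case by time reversal
`γ ∘ (· * (-1))`, an integral curve of `-V`, which lifts `-c`).  Let `g` be `C¹`,
`dg_x(V x) = c` on `C`, `Q ⊆ F` open with `g⁻¹(Q) ⊆ C`, `γ` an integral curve of `V` on `ℝ`,
and `t` a time with `g (γ 0) + s • c ∈ Q` for all `s` between `0` and `t`.  Then
`g (γ s) = g (γ 0) + s • c` for all `s` between `0` and `t`. [cite: BrockerJanichIDT1982, (8.12) (proof)] -/
theorem apply_integralCurve_eq_add_smul_of_segment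
    (hg : ContMDiff I 𝓘(ℝ, F) 1 g) (hc : ∀ x ∈ C, mfderiv I 𝓘(ℝ, F) g x (V x) = c)
    {Q : Set F} (hQ : IsOpen Q) (hQC : g ⁻¹' Q ⊆ C) {γ : ℝ → M} (hγ : IsMIntegralCurve γ V)
    {t : ℝ} (hseg : ∀ s ∈ uIcc 0 t, g (γ 0) + s • c ∈ Q) {s : ℝ} (hs : s ∈ uIcc 0 t) :
    g (γ s) = g (γ 0) + s • c := by
  rcases le_total 0 t with ht | ht
  · rw [uIcc_of_le ht] at hseg hs
    exact apply_integralCurve_eq_add_smul_of_segment_of_nonneg hg hc hQ hQC hγ ht hseg hs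
  · rw [uIcc_of_ge ht] at hseg hs
    -- time reversal
    have hγ' : IsMIntegralCurve (γ ∘ (· * (-1 : ℝ))) ((-1 : ℝ) • V) := hγ.comp_mul (-1)
    have hc' : ∀ x ∈ C, mfderiv I 𝓘(ℝ, F) g x (((-1 : ℝ) • V) x) = (-1 : ℝ) • c := by
      intro x hx
      rw [Pi.smul_apply, map_smul, hc x hx]
      rfl
    have hseg' : ∀ r ∈ Icc 0 (-t), g ((γ ∘ (· * (-1 : ℝ))) 0) + r • ((-1 : ℝ) • c) ∈ Q := by
      intro r hr
      have h := hseg (-r) ⟨by linarith [hr.2], by linarith [hr.1]⟩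
      show g (γ (0 * (-1))) + r • ((-1 : ℝ) • c) ∈ Q
      rw [zero_mul, smul_smul, mul_neg_one]
      exact h
    have h := apply_integralCurve_eq_add_smul_of_segment_of_nonneg hg hc' hQ hQC hγ' (by linarith)
      hseg' (s := -s) ⟨by linarith [hs.2], by linarith [hs.1]⟩
    simp only [comp_apply, smul_smul] at h
    rw [zero_mul] at h
    simp only [neg_mul_neg, mul_one] at h
    exact h

end Literature.Geometry.Manifold

end
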